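import Summits.Schanuel.Schanuel.Theorems.RootDecomp1KDegreeLadder05
import Summits.Schanuel.Schanuel.Theorems.RootDecomp1KDarkLogSq04

/-!
# RootDecomp1KCollarCell — lens 1, generation 48, node 7 «THE COLLAR CELL: skeleton-RESONANT dyadic approximants are never level points (2-adic interlacing, all P, m-free), with a certified member of EXACT Skel-order m» (CLAIM L2417, EX-ANTE PRICE + CHECKLIST K-g48 L2418, NODE L2431 / REQUEST L2432; critic VERDICT L2435: CLEARED AS PRICED — ONE CELL ×1 «DYADIC COLLAR», RULE K-R37, PORT GO) — part 1 (RootDecomp1KCollarCell01): §1 (T1) the 2-adic interlacing lemma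

(lens-1 g48 HOME kernel K = HOME/decomp-schanuel-lens-1/g48/CollarCell.lean f82e9183…, 1281 l, imports …RootDecomp1KDegreeLadder05 + …RootDecomp1KDarkLogSq04 BY NAME; P CollarCellProbe.lean 50792f78… rc 0 / C CollarCellCtrl.lean 9aabc182… rc 1 = 14 planted; memo NODE-g48.md; NODE L2431 / REQUEST L2432. Port by census-1 gen 21 as `RootDecomp1KCollarCell01–06` along K's §1–§5 with §3 cut in two by the 400-line file cap: 01 = §1 (T1) the 2-adic interlacing lemma `twoAdic_bev_ne_zero` with `maxval₂`, `weights_injective`; 02 = §2 the class `DyadicCollarLiouville` («[class] definition» tag) and its engine `bev_ne_zero_of_collar` (T2), `algebraicIndependent_ell2_of_collar` (T3), `statement_b_on_collar_ge_one`, `not_dyadicCollarLiouville_uStar`, `sb_collarPair` / `coordLiouvilleSchanuel_collarPair` (T4, item 31077's binders verbatim at n = 2, whole class, hyp-free); 03 = §3a the run pattern `Nn`/`fN`/`gN`, increments `aN`, `rhoNat`, tails `tailN`; 04 = §3b numerators `MN`, truncations `tN`, overshoots `uN`/`UN`, `iota_two_pow_fN`, `rhoNat_ne_tN`; 05 = §4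 certificates M1 `dyadicCollarLiouville_rhoNat`, M2 `skelLiouvilleFix_rhoNat`, cover `rhoNat_cover`, M3 `not_skelLiouvilleFix_succ_rhoNat` / `not_skelLiouville_rhoNat`, M4 `not_factorialGapLiouville_rhoNat`, M5 `not_logLogLiouville_rhoNat` + `not_logSqLiouville_rhoNat` / `not_logHyperLiouville_rhoNat` / `not_hyperLiouville_rhoNat` / `not_liouvilleOrder_rhoNat`, `liouville_rhoNat`, `dyadicCollarLiouville_not_subset`; 06 = §5 the exhibited tuple `zN2 = (ℓ₂, ρ♮₂)`: `linearIndependent_zN2`, `coordLiouvilleSpan_zN2`, `zN2_in_scope_31077`, `sb_zN2`, `coordLiouvilleSchanuel_at_zN2`, `item31077_at_zN2`, `rhoNat_two_profile` — ALL HYP-FREE. PORT EDITS (census convention, as sanctioned for every K-line port): `set_option linter.dupNamespace false` dropped; «[class] definition (membership predicate with parameters, NOT a fact; census convention)» wording on `DyadicCollarLiouville`; 35 one-line helper docstrings added; per-part private helper copies if any; statements and proofs otherwise verbatim (no renames). `--supports stmt-Schanuel-31077`; no census credit carried; rung 0 — nothing here proves Schanuel; no ∀-item moves; 31077 and 33364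 stay OPEN.)
-/

/-!
# RootDecomp1KCollarCell — lens 1, generation 48, node 7 (g48) «THE COLLAR CELL: skeleton-RESONANT dyadic
# approximants are never level points (2-adic interlacing, all `P`, `m`-free), with a certified member of EXACT
# Skel-order `m`»

(lens-1 g48 HOME kernel K = `HOME/decomp-schanuel-lens-1/g48/CollarCell.lean`; CLAIM STATUS L2417, ex-ante PRICE L2418
«ONE CELL ×1 under K-R16/K-R26 iff CHECKLIST K-g48»; P = `CollarCellProbe.lean` rc 0, C = `CollarCellCtrl.lean` rc 1;
TWO tree imports BY NAME: `…Theorems.RootDecomp1KDegreeLadder05` (cone: `Theses.RootDecomp1K`, DegreeLadder01–05,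
SkelCell01–10, GapCell01, TwoBaseCell, LogLogCell01, RelLiouvilleCell, Hyper, Generic13/17) and
`…Theorems.RootDecomp1KDarkLogSq04` (only for `logHyperLiouville_of_liouvilleOrder`, §4 M5); no `EclCore`/`DiophantineCore`,
no hypothesis binder (`hNW`/`hX`/fact) anywhere, no `sorry`, no `native_decide`, no `decide` (numerals only via `norm_num`
/ `norm_num [Nat.factorial]` / `omega`), no `maxHeartbeats` override, no new `instance`/`notation`; no ledger writes.)

ONE HONEST SENTENCE: ONE CELL; rung 0; no ∀-item moves; 31077 and 33364 stay OPEN; NOT lane (ii), NOT the class-level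
(b)-cell (`Skel₍m₎ ⊄ Collar`, witness the tree's `u⋆`); engine = elementary ultrametric (2-adic) weight separation —
a known principle, NEW to this line; the location regime (the COLLAR of the skeleton) is new; exact-order members also
exist inside the GAP cell (decided by g42 `sb_gapPair` BY NAME, not exhibited here).

## The class (order + 2-adic location data only)
`DyadicCollarLiouville ρ := ∀ A K, ∃ N ≥ K, ∃ h ≥ A, A·h ≤ N! ∧ ∃ t : ℚ, den t = 2^{N!+h} ∧ |ρ − t| < den t^{−A}`:
approximants of every polynomial quality `A` whose (dyadic) denominators sit in the COLLAR `(2^{N!+A}, 2^{N!(1+1/A)}]`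
of the skeleton point `2^{N!}` — the location regime complementary to g42's GAPS `(2^{A·N!}, 2^{(N+1)!/A})`
(`RootDecomp1KGapCell.FactorialGapLiouville`) and to the skeleton points themselves (`h = 0`).

## The engine (T1–T4, §1–§2)
* (T1) `twoAdic_bev_ne_zero`: for `P ∈ ℤ[x][y]`, `P ≠ 0`, odd `p, M`, `h > maxval₂ P` and `F > deg_y P · h + maxval₂ P`:
  `P(p/2^F, M/2^{F+h}) ≠ 0` — the 2-adic weights `v₂(c_ij) − (i+j)F − jh` of the monomials are pairwise distinct, so
  the cleared value is `2^w·(odd)`.  (`maxval₂ P` = the largest `v₂` of a coefficient, `v₂(0) = 0` by Mathlib's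
  convention, a `Finset.sup` over the coefficient box; `bev`/`xdeg` = tree `RootDecomp1KDegreeLadder` BY NAME.)
* (T2) `bev_ne_zero_of_collar`: `ρ ∈ DyadicCollarLiouville ⇒ P(ℓ₂, ρ) ≠ 0` for every `P ≠ 0` — SIMULTANEOUS
  specialisation at MATCHED heights `(s_N, t)` (`s_N = psNumer/2^{N!}`, odd numerator, tree `coprime_psNumer`):
  T1 + integrality (`aeval_specX`, `abs_aeval_ge_of_ne_zero`) against Lipschitz (`lipschitz_x`, `lipschitz_y`).
* (T3) `algebraicIndependent_ell2_of_collar` (tree `algebraicIndependent_of_no_relation`, DL05), HYP-FREE;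
  (T4) `sb_collarPair`, `coordLiouvilleSchanuel_collarPair` = item 31077's binders VERBATIM at `n = 2` + ONE range line
  (tree `sb_of_algebraicIndependent`, `sb_of_range_eq'`), for the WHOLE class, HYP-FREE.
* `statement_b_on_collar_ge_one`: statement (b) of the K-line («`ρ ∈ Skel₍m₎ ⇒ ℓ₂ ⫫ ρ`») holds ON THE COLLAR CLASS for
  every `m ≥ 1` (= T3 restricted); `not_dyadicCollarLiouville_uStar`: the tree's `u⋆ ∈ Skel₍₁₎` is NOT collar.

## The member (§3–§4): `ρ♮_m`, EXACT Skel-order `m`, every `m ≥ 1`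
`ρ♮_m := 2^{−f_0} + Σ_k (2^{1−g_k} − 2^{−f_{k+1}})`, `N_k = m+4+2k`, `f_k = N_k! + N_k`, `g_k = m(N_k+1)f_k + 1` (binary
expansion: ZEROS on `(f_k, g_k)`, ONES on `[g_k, f_{k+1}]`); truncations `t_k` (`den 2^{f_k}`), overshoots `u_k`
(`den 2^{g_k−1}`).  M1 `dyadicCollarLiouville_rhoNat`; M2 `skelLiouvilleFix_rhoNat : ρ♮_m ∈ Skel₍m₎`;
M3 `not_skelLiouvilleFix_succ_rhoNat : ρ♮_m ∉ Skel₍m+1₎` (EXACT order; covering lemma `rhoNat_cover`: every rational with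
`den ≥ 2^{f_0}` is a `t_k`, a `u_k`, or `≥ 1/(8 den⁴)` away), hence `not_skelLiouville_rhoNat`;
M4 `not_factorialGapLiouville_rhoNat`; M5 `not_logLogLiouville_rhoNat` and, by the tree's implications BY NAME,
`∉ LogSq ∪ LogHyper ∪ Hyper ∪ ⋃_{k≥1} LiouvilleOrder k`; `dyadicCollarLiouville_not_subset`.

## The exhibited tuple (§5)
`z♮₂ := (ℓ₂, ρ♮₂)`: `linearIndependent_zN2`, `coordLiouvilleSpan_zN2` (Mathlib `liouville_liouvilleNumber`),
`zN2_in_scope_31077`, `sb_zN2`, `coordLiouvilleSchanuel_at_zN2`, `item31077_at_zN2` — ALL HYP-FREE; `rhoNat_two_profile`: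
`ρ♮₂ ∈ Collar ∩ Skel₍2₎ ∖ (Skel₍3₎ ∪ FactorialGap ∪ LogLog)`.  NOT CLAIMED: 33364 / walls `(1, ℓ₂, ρ)` / π-twins (node 8).
-/

noncomputable section

open Polynomial LiouvilleNumber
open scoped Nat

namespace Summit.Schanuel.Schanuel.Theorems.RootDecomp1KCollarCell

open Summit.Schanuel.Schanuel.Theorems.RootDecomp1KDegreeLadder
  (bev bev_eq_double_sum xdeg natDegree_coeff_le_xdeg specX aeval_specX natDegree_specX_le
   abs_aeval_ge_of_ne_zero lipschitz_x lipschitz_y algebraicIndependent_of_no_relation)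
open Summit.Schanuel.Schanuel.Theorems.RootDecomp1KSkelCell
  (iota iota_spec iota_le_of_le pow_lt_of_lt_iota lt_iota_of_pow_lt iota_mono one_le_iota
   SkelLiouville SkelLiouvilleFix skelLiouville_iff_fix SkelLiouvilleFix.mono logLogLiouville_skelLiouville)
open Summit.Schanuel.Schanuel.Theorems.RootDecomp1KLogLogCell
  (LogLogLiouville logLogLiouville_of_logSqLiouville logLogLiouville_of_logHyperLiouville
   logLogLiouville_of_hyperLiouville)
open Summit.Schanuel.Schanuel.Theorems.RootDecomp1KGeneric (LogSqLiouville LiouvilleOrder)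
open Summit.Schanuel.Schanuel.Theorems.RootDecomp1KRelLiouvilleCell (LogHyperLiouville)
open Summit.Schanuel.Schanuel.Theorems.RootDecomp1KDarkLogSq (logHyperLiouville_of_liouvilleOrder)
open Summit.Schanuel.Schanuel.Theorems.RootDecomp1KTwoBaseCell
  (psNumer partialSum_eq_psNumer_div coprime_psNumer sb_of_range_eq')
open Summit.Schanuel.Schanuel.Theorems.RootDecomp1KGapCell (FactorialGapLiouville)
open Summit.Schanuel.Schanuel.Theorems.RootDecomp1KHyper
open Summit.Schanuel.Schanuel.Theorems.RootDecomp1KHyper.HyperCell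

/-! ## §1  (T1) THE 2-ADIC INTERLACING LEMMA: `P(p/2^F, M/2^{F+h}) ≠ 0` -/
section TwoAdic

/-- A finite sum of integers is non-zero as soon as one term is non-zero and the non-zero terms have pairwise
distinct 2-adic valuations (the term of least valuation survives modulo `2^{v₀+1}`). -/
theorem sum_ne_zero_of_padicValInt_inj {ι : Type*} (s : Finset ι) (f : ι → ℤ)
    (hne : ∃ i ∈ s, f i ≠ 0)
    (hinj : ∀ i ∈ s, ∀ i' ∈ s, f i ≠ 0 → f i' ≠ 0 →
      padicValInt 2 (f i) = padicValInt 2 (f i') → i = i') :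
    ∑ i ∈ s, f i ≠ 0 := by
  classical
  set s' := s.filter (fun i => f i ≠ 0) with hs'
  have hs'ne : s'.Nonempty := by
    obtain ⟨i, hi, hfi⟩ := hne
    exact ⟨i, Finset.mem_filter.mpr ⟨hi, hfi⟩⟩
  obtain ⟨i₀, hi₀, hmin⟩ := s'.exists_min_image (fun i => padicValInt 2 (f i)) hs'ne
  have hi₀s : i₀ ∈ s := (Finset.mem_filter.mp hi₀).1
  have hf₀ : f i₀ ≠ 0 := (Finset.mem_filter.mp hi₀).2
  set v₀ := padicValInt 2 (f i₀) with hv₀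
  have hdvd : ∀ i ∈ s, i ≠ i₀ → (2 : ℤ) ^ (v₀ + 1) ∣ f i := by
    intro i hi hne'
    by_cases hfi : f i = 0
    · rw [hfi]; exact dvd_zero _
    · have hmem : i ∈ s' := Finset.mem_filter.mpr ⟨hi, hfi⟩
      have hle : v₀ ≤ padicValInt 2 (f i) := hmin i hmem
      have hlt : v₀ < padicValInt 2 (f i) := by
        rcases hle.eq_or_lt with h | h
        · exact absurd (hinj i hi i₀ hi₀s hfi hf₀ h.symm) hne'
        · exact h
      have := (padicValInt_dvd_iff (p := 2) (v₀ + 1) (f i)).mpr (Or.inr hlt)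
      simpa using this
  intro hsum
  have hsplit : ∑ i ∈ s, f i = f i₀ + ∑ i ∈ s.erase i₀, f i := (Finset.add_sum_erase s f hi₀s).symm
  have hdvd' : (2 : ℤ) ^ (v₀ + 1) ∣ ∑ i ∈ s.erase i₀, f i :=
    Finset.dvd_sum fun i hi => hdvd i (Finset.mem_of_mem_erase hi) (Finset.ne_of_mem_erase hi)
  have hf₀dvd : (2 : ℤ) ^ (v₀ + 1) ∣ f i₀ := by
    have e : f i₀ = -(∑ i ∈ s.erase i₀, f i) := by linarith [hsum, hsplit]
    rw [e]; exact (dvd_neg).mpr hdvd'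
  have h2 := (padicValInt_dvd_iff (p := 2) (v₀ + 1) (f i₀)).mp (by simpa using hf₀dvd)
  rcases h2 with h | h
  · exact hf₀ h
  · omega

/-- `v₂(2^w) = w` on `ℤ`. -/
private theorem padicValInt_two_pow (w : ℕ) : padicValInt 2 ((2 : ℤ) ^ w) = w := by
  have e : ((2 : ℤ) ^ w) = ((2 ^ w : ℕ) : ℤ) := by push_cast; rfl
  rw [e, padicValInt.of_nat, padicValNat.prime_pow]

/-- An odd integer has `v₂ = 0`. -/
private theorem padicValInt_eq_zero_of_odd {z : ℤ} (hz : Odd z) : padicValInt 2 z = 0 := by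
  refine padicValInt.eq_zero_of_not_dvd ?_
  intro h
  have h' : (2 : ℤ) ∣ z := by simpa using h
  exact (Int.not_even_iff_odd.mpr hz) (even_iff_two_dvd.mpr h')

/-- The largest 2-adic valuation of a (listed) integer coefficient of `P ∈ ℤ[x][Y]`. -/
def maxval₂ (P : ℤ[X][X]) : ℕ :=
  (Finset.range (P.natDegree + 1)).sup fun j =>
    (Finset.range (xdeg P + 1)).sup fun i => padicValInt 2 ((P.coeff j).coeff i)

/-- `v₂(c_{ij}) ≤ maxval₂ P`. -/
theorem padicValInt_coeff_le_maxval₂ (P : ℤ[X][X]) {i j : ℕ} (hi : i ≤ xdeg P) (hj : j ≤ P.natDegree) :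
    padicValInt 2 ((P.coeff j).coeff i) ≤ maxval₂ P := by
  unfold maxval₂
  refine le_trans ?_ (Finset.le_sup (f := fun j => (Finset.range (xdeg P + 1)).sup fun i =>
    padicValInt 2 ((P.coeff j).coeff i)) (Finset.mem_range.mpr (Nat.lt_succ_of_le hj)))
  exact Finset.le_sup (f := fun i => padicValInt 2 ((P.coeff j).coeff i))
    (Finset.mem_range.mpr (Nat.lt_succ_of_le hi))

/-- The weight bookkeeping: `v + (a−i)F + (d−j)(F+h)` is injective in `(i, j)` when `v ≤ V < h` and
`d·h + V < F` (equal `i+j`: separated by `h`; unequal: separated by `F`). -/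
theorem weights_injective {F h V a d i j i' j' v v' : ℕ} (hh : V < h) (hF : d * h + V < F)
    (hi : i ≤ a) (hj : j ≤ d) (hi' : i' ≤ a) (hj' : j' ≤ d) (hv : v ≤ V) (hv' : v' ≤ V)
    (heq : v + ((a - i) * F + (d - j) * (F + h)) = v' + ((a - i') * F + (d - j') * (F + h))) :
    i = i' ∧ j = j' := by
  set u := a - i with hu
  set w := d - j with hw
  set u' := a - i' with hu'
  set w' := d - j' with hw'
  have hwd : w ≤ d := Nat.sub_le d j
  have hwd' : w' ≤ d := Nat.sub_le d j'
  have key : v + w * h + (u + w) * F = v' + w' * h + (u' + w') * F := by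
    have e1 : (a - i) * F + (d - j) * (F + h) = w * h + (u + w) * F := by rw [← hu, ← hw]; ring
    have e2 : (a - i') * F + (d - j') * (F + h) = w' * h + (u' + w') * F := by rw [← hu', ← hw']; ring
    rw [e1, e2] at heq; linarith
  have hwh : w * h ≤ d * h := Nat.mul_le_mul_right h hwd
  have hwh' : w' * h ≤ d * h := Nat.mul_le_mul_right h hwd'
  rcases Nat.lt_trichotomy (u + w) (u' + w') with hlt | hEq | hgt
  · exfalso
    have h1 : (u + w) * F + F ≤ (u' + w') * F := by
      have := Nat.mul_le_mul_right F hlt; rwa [Nat.succ_mul] at this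
    omega
  · have key2 : v + w * h = v' + w' * h := by rw [hEq] at key; omega
    rcases Nat.lt_trichotomy w w' with hlt2 | hEq2 | hgt2
    · exfalso
      have h3 : w * h + h ≤ w' * h := by
        have := Nat.mul_le_mul_right h hlt2; rwa [Nat.succ_mul] at this
      omega
    · have hu2 : u = u' := by omega
      constructor <;> omega
    · exfalso
      have h3 : w' * h + h ≤ w * h := by
        have := Nat.mul_le_mul_right h hgt2; rwa [Nat.succ_mul] at this
      omega
  · exfalso
    have h1 : (u' + w') * F + F ≤ (u + w) * F := by
      have := Nat.mul_le_mul_right F hgt; rwa [Nat.succ_mul] at this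
    omega

/-- Clearing one coordinate: `(q/2^F)^i · 2^{aF} = q^i · 2^{(a−i)F}` for `i ≤ a`. -/
theorem div_two_pow_pow_mul {q : ℝ} {F i a : ℕ} (hi : i ≤ a) :
    (q / 2 ^ F) ^ i * (2 : ℝ) ^ (a * F) = q ^ i * (2 : ℝ) ^ ((a - i) * F) := by
  have e : a * F = F * i + (a - i) * F := by
    rw [Nat.mul_comm F i, ← Nat.add_mul, Nat.add_sub_cancel' hi]
  rw [e, pow_add, div_pow, ← pow_mul]
  have h2 : (2 : ℝ) ^ (F * i) ≠ 0 := pow_ne_zero _ two_ne_zero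
  field_simp

/-- **(T1) THE 2-ADIC INTERLACING LEMMA.**  `P ∈ ℤ[x][Y]` non-zero, `s = p/2^F`, `t = M/2^{F+h}` with `p, M` odd,
`maxval₂ P < h` and `deg_Y P · h + maxval₂ P < F`: then `P(s, t) ≠ 0`.  The monomial `c_{ij} s^i t^j` has 2-adic
valuation `v₂(c_{ij}) − (i+j)·F − j·h`; these are pairwise distinct (equal `i+j` is separated by `h > maxval₂`,
unequal `i+j` by `F > d·h + maxval₂`), so the cleared sum is `2^{w₀}·(odd) ≠ 0`.  No size hypothesis, all `P`. -/
theorem twoAdic_bev_ne_zero (P : ℤ[X][X]) (hP : P ≠ 0) {F h : ℕ} {p M : ℤ} (hp : Odd p) (hM : Odd M)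
    (hh : maxval₂ P < h) (hF : P.natDegree * h + maxval₂ P < F) :
    bev P ((p : ℝ) / 2 ^ F) ((M : ℝ) / 2 ^ (F + h)) ≠ 0 := by
  classical
  set a := xdeg P with ha
  set d := P.natDegree with hd
  set x : ℝ := (p : ℝ) / 2 ^ F with hx
  set y : ℝ := (M : ℝ) / 2 ^ (F + h) with hy
  set term : ℕ × ℕ → ℤ := fun ji =>
    (P.coeff ji.1).coeff ji.2 * p ^ ji.2 * M ^ ji.1 * 2 ^ ((a - ji.2) * F + (d - ji.1) * (F + h)) with hterm
  set s : Finset (ℕ × ℕ) := Finset.range (d + 1) ×ˢ Finset.range (a + 1) with hs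
  -- (1) clearing denominators: `P(x, y) · 2^{aF} · 2^{d(F+h)} = Σ term`
  have hcast : bev P x y * ((2 : ℝ) ^ (a * F) * (2 : ℝ) ^ (d * (F + h))) = ((∑ ji ∈ s, term ji : ℤ) : ℝ) := by
    rw [hs, Finset.sum_product, bev_eq_double_sum, Finset.sum_mul]
    push_cast
    refine Finset.sum_congr rfl fun j hj => ?_
    rw [Finset.sum_mul, Finset.sum_mul]
    refine Finset.sum_congr rfl fun i hi => ?_
    have hi' : i ≤ a := Nat.lt_succ_iff.mp (Finset.mem_range.mp hi)
    have hj' : j ≤ d := Nat.lt_succ_iff.mp (Finset.mem_range.mp hj)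
    have hxi := div_two_pow_pow_mul (q := (p : ℝ)) (F := F) hi'
    have hyj := div_two_pow_pow_mul (q := (M : ℝ)) (F := F + h) hj'
    simp only [hterm]
    push_cast
    calc (((P.coeff j).coeff i : ℤ) : ℝ) * x ^ i * y ^ j * ((2 : ℝ) ^ (a * F) * (2 : ℝ) ^ (d * (F + h)))
        = (((P.coeff j).coeff i : ℤ) : ℝ) * (x ^ i * (2 : ℝ) ^ (a * F)) * (y ^ j * (2 : ℝ) ^ (d * (F + h))) := by
          ring
      _ = (((P.coeff j).coeff i : ℤ) : ℝ) * ((p : ℝ) ^ i * (2 : ℝ) ^ ((a - i) * F)) *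
            ((M : ℝ) ^ j * (2 : ℝ) ^ ((d - j) * (F + h))) := by rw [hx, hy, hxi, hyj]
      _ = _ := by ring
  -- (2) the cleared sum is non-zero
  have hp0 : p ≠ 0 := by rintro rfl; obtain ⟨k, hk⟩ := hp; omega
  have hM0 : M ≠ 0 := by rintro rfl; obtain ⟨k, hk⟩ := hM; omega
  have hval : ∀ ji ∈ s, term ji ≠ 0 →
      padicValInt 2 (term ji) = padicValInt 2 ((P.coeff ji.1).coeff ji.2) +
        ((a - ji.2) * F + (d - ji.1) * (F + h)) := by
    intro ji hji hne
    have hc : (P.coeff ji.1).coeff ji.2 ≠ 0 := by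
      intro h0; apply hne; simp only [hterm, h0, zero_mul]
    have hpi : (p ^ ji.2) ≠ 0 := pow_ne_zero _ hp0
    have hMj : (M ^ ji.1) ≠ 0 := pow_ne_zero _ hM0
    have h2w : ((2 : ℤ) ^ ((a - ji.2) * F + (d - ji.1) * (F + h))) ≠ 0 := pow_ne_zero _ two_ne_zero
    simp only [hterm]
    rw [padicValInt.mul (mul_ne_zero (mul_ne_zero hc hpi) hMj) h2w,
      padicValInt.mul (mul_ne_zero hc hpi) hMj, padicValInt.mul hc hpi,
      padicValInt_eq_zero_of_odd (hp.pow), padicValInt_eq_zero_of_odd (hM.pow), padicValInt_two_pow]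
    ring
  have hZ : ∑ ji ∈ s, term ji ≠ 0 := by
    refine sum_ne_zero_of_padicValInt_inj s term ?_ ?_
    · -- the leading coefficient gives a non-zero term
      have hPd : P.coeff d ≠ 0 := by rw [hd]; exact Polynomial.leadingCoeff_ne_zero.mpr hP
      set i₀ := (P.coeff d).natDegree with hi₀
      have hc : (P.coeff d).coeff i₀ ≠ 0 := by rw [hi₀]; exact Polynomial.leadingCoeff_ne_zero.mpr hPd
      have hi₀a : i₀ ≤ a := by rw [hi₀, ha]; exact natDegree_coeff_le_xdeg P d
      refine ⟨(d, i₀), ?_, ?_⟩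
      · rw [hs, Finset.mem_product]
        exact ⟨Finset.mem_range.mpr (Nat.lt_succ_self _), Finset.mem_range.mpr (Nat.lt_succ_of_le hi₀a)⟩
      · simp only [hterm]
        exact mul_ne_zero (mul_ne_zero (mul_ne_zero hc (pow_ne_zero _ hp0)) (pow_ne_zero _ hM0))
          (pow_ne_zero _ two_ne_zero)
    · intro ji hji ji' hji' hne hne' hv
      rw [hval ji hji hne, hval ji' hji' hne'] at hv
      rw [hs, Finset.mem_product, Finset.mem_range, Finset.mem_range] at hji hji'
      have hi : ji.2 ≤ a := by omega
      have hj : ji.1 ≤ d := by omega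
      have hi' : ji'.2 ≤ a := by omega
      have hj' : ji'.1 ≤ d := by omega
      obtain ⟨h1, h2⟩ := weights_injective (V := maxval₂ P) hh hF hi hj hi' hj'
        (padicValInt_coeff_le_maxval₂ P hi hj) (padicValInt_coeff_le_maxval₂ P hi' hj') hv
      exact Prod.ext h2 h1
  -- (3) conclude
  intro h0
  have : ((∑ ji ∈ s, term ji : ℤ) : ℝ) = 0 := by rw [← hcast, h0, zero_mul]
  exact hZ (by exact_mod_cast this)

end TwoAdic

end Summit.Schanuel.Schanuel.Theorems.RootDecomp1KCollarCell

end
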